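import Summits.AnomalousDissipation.AnomalousDissipation.Theorems.SawtoothPulseCascadeK1LocalisedCascadeCanonicalStripStepsOsc
import Summits.AnomalousDissipation.AnomalousDissipation.Theorems.SawtoothPulseCascadeK1LocalisedCascadeCanonicalBlocksMax

/-!
# K1loc — THE (T-H) STEP AT AN ARBITRARY WINDOW `K`, OSCILLATORY GRADE (numeric layer)

Prover lane on the crux `K1LocalisedCascade` (stmt-AnomalousDissipation-19491), route `SawtoothPulseCascade`
(S-B/S-C assembly seat; the LEDGER ASSEMBLY, numeric layer, Osc grade; companion of `…PhaseTH`).  The low-fibre step (T-H)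
of the fibre ledger at shape `γ = 8, d = 2, N₀ = 1, ρ_N = 2` for an ARBITRARY window `K ≥ 6` (so that any schedule, e.g.
`K_j = 800·25^{j−2}`, can be instantiated): low fibres `|k₁| < 5K` of `b_j`, exact part `S_j(K) = Σ'[|k₀| < K]‖𝓕a_j‖²`,
canonical blocks `Λ_m = K·2^m` with margin `2`, `max`-family cut-offs `t = 1/2`, feed `O_j(K) = Σ'[K ≤ |k₀| ∧ |k₀| ≤ 4|k₁|]‖𝓕a_j‖²`,
`M_b = 7j + 12`, rounding target `η = (ε/(15·8π·4096·K))·64^{−j}`, over ad-sawtooth-k1loc-p1's OSCILLATORY window blocks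
(`…CanonicalStripStepsOsc.lowFibre_hstep_canonicalOsc_le`): plain cut-off ratio `r* = 2`, plain input kernel `A* = 15`
(exact), block denominators `D₀ = K`:
  `T_j(5K) ≤ S_j(K) + ((√J_T + √O_j(K))² + ((1+γ)^{2j}/(K·2^{7j+12}))²)`,
  `J_T = 12·((4/3)ε² + (4/3)(2·2^j/(πK))² + 120·2^j/(πK) + (7j+12)(1800·2^j·√(4Mδ_j/(πK)) + 1800·Mδ_j/π))`,
`Mδ_j = max(1,√(2log(1/η)))·δ_j`; the only hypothesis left is `Mδ_j < π/2`.
No definitions; no statement about the crux. [cite: Grafakos2014, Prop. 3.1.2 (5), Prop. 3.2.7 (3), §3.1.3] [problem: turb]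
-/

-- `Summit.<Summit>.<Problem>`: single-conjunct summit, the duplicate namespace segment is deliberate.
set_option linter.dupNamespace false

noncomputable section

namespace Summit.AnomalousDissipation.AnomalousDissipation.Theorems.SawtoothPulseCascade.K1Window

open MeasureTheory Set Filter Topology UnitAddTorus Function Complex Metric
open scoped Real ENNReal
open Literature.Analysis Literature.Analysis.FunctionSpaces Literature.Analysis.FunctionSpaces.Torus Literature.Analysis.FluidPDE
open Literature.Analysis.FluidPDE.ShearStage
open Literature.Analysis.FluidPDE.SawtoothCascade Literature.Analysis.FluidPDE.SawtoothCascade.CascadeParams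
open Summit.AnomalousDissipation.AnomalousDissipation.Theorems.SawtoothPulseCascade.K1Start
open Summit.AnomalousDissipation.AnomalousDissipation.Theorems.SawtoothPulseCascade.K1Flat
open Summit.AnomalousDissipation.AnomalousDissipation.Theorems.SawtoothPulseCascade.K1Ledger.From

/-- **The plain cut-off ratio of the fat (T-H) blocks is at most `2`** (max family, `t = 1/2`, `β = 2`, `Λ₀ ≥ 6`:
`r* = (5Λ₀/2 + 1)/(3Λ₀/2 − 1) ≤ 2`). [folklore] -/
theorem fat_cutoff_le {Λ0 : ℕ} (hΛ0 : 6 ≤ Λ0) (m : ℕ) :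
    (((max (2 * 1 * (Λ0 * 2 ^ m) / 4) 0 : ℕ) : ℝ) + ((2 * (Λ0 * 2 ^ m) / 1 : ℕ) : ℝ)) /
        (((2 * (Λ0 * 2 ^ m) / 1 : ℕ) : ℝ) - ((max (2 * 1 * (Λ0 * 2 ^ m) / 4) 0 : ℕ) : ℝ)) ≤ 2 := by
  have h1 : 2 * 1 * 2 ≤ 1 * 4 := by norm_num
  have h2 : 0 * 2 ≤ 1 * Λ0 := by simp
  have h3 : 1 * 1 * Λ0 + 2 * 1 * 2 ≤ 2 * 2 * Λ0 := by omega
  have hr := canonMax_r_le (u' := 1) (v' := 4) (Y₀ := 0) (tn := 1) (td := 2) (qn := 2) (qd := 1) (Λ0 := Λ0)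
    (by norm_num) (by norm_num) (by norm_num) h1 h2 h3 m
  have hΛ0r : (6 : ℝ) ≤ Λ0 := by exact_mod_cast hΛ0
  have hden : (0 : ℝ) < (((2 : ℕ) : ℝ) / ((1 : ℕ) : ℝ) - ((1 : ℕ) : ℝ) / ((2 : ℕ) : ℝ)) * (Λ0 : ℝ) - 1 := by
    push_cast; linarith
  have hrs2 : ((((1 : ℕ) : ℝ) / ((2 : ℕ) : ℝ) + ((2 : ℕ) : ℝ) / ((1 : ℕ) : ℝ)) * (Λ0 : ℝ) + 1) /
      ((((2 : ℕ) : ℝ) / ((1 : ℕ) : ℝ) - ((1 : ℕ) : ℝ) / ((2 : ℕ) : ℝ)) * (Λ0 : ℝ) - 1) ≤ 2 := by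
    rw [div_le_iff₀ hden]
    push_cast; linarith
  exact hr.trans hrs2

section Cascade

variable (P : CascadeParams)

set_option maxHeartbeats 400000 in
/-- **(T-H) AT AN ARBITRARY WINDOW, OSCILLATORY GRADE** (see the file header): for every phase `j` and every `K ≥ 6`,
`T_j(5K) ≤ S_j(K) + ((√J_T + √O_j(K))² + ((1+γ)^{2j}/(K2^{7j+12}))²)`. [cite: Grafakos2014, Prop. 3.1.2 (5), Prop. 3.2.7 (3), §3.1.3] -/
theorem lowFibre_hstep_osc_le (hγ : P.γ = 8) (hδ₀ : 0 < P.δ₀) (hd : P.d = 2) (hN₀ : P.N₀ = 1) (hρN : P.ρN = 2)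
    (a b : ℕ → UnitAddTorus (Fin 2) → ℝ) (has : ∀ j, IsSmooth (a j)) (h0 : a 0 = datum)
    (hb : ∀ j, b j = a j ∘ shearMap 0 1 (amp ⟨P.U j, P.U_periodic j, P.contDiff_U (P.δ_pos hδ₀ (by rw [hd]; norm_num) j)⟩ P.γ))
    (hab : ∀ j, a (j + 1) = b j ∘ shearMap 1 0 (amp ⟨P.U j, P.U_periodic j, P.contDiff_U (P.δ_pos hδ₀ (by rw [hd]; norm_num) j)⟩ P.γ))
    {K : ℕ} (hK : 6 ≤ K) {ε : ℝ} (hε : 0 < ε) (j : ℕ)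
    (hMδ : max 1 (Real.sqrt (2 * Real.log (1 / (ε / (15 * π * 8 * 4096 * (K : ℝ)) * (1 / 64) ^ j)))) * P.δ j < π / 2) :
    ∑' k : Fin 2 → ℤ, (if |k 1| < ((5 * K : ℕ) : ℤ) then (1 : ℝ) else 0) * ‖mFourierCoeff (fun x => (b j x : ℂ)) k‖ ^ 2 ≤
      ∑' k : Fin 2 → ℤ, (if |k 0| < (K : ℤ) then (1 : ℝ) else 0) * ‖mFourierCoeff (fun x => (a j x : ℂ)) k‖ ^ 2 +
      ((Real.sqrt (3 * 2 ^ 2 *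
            (4 / 3 * ε ^ 2 + 4 / 3 * (2 * 2 ^ j / (π * (K : ℝ))) ^ 2 + 8 * 2 ^ j * 15 / (π * (K : ℝ)) +
              ((7 * j + 12 : ℕ) : ℝ) * (8 * 2 ^ j * 15 ^ 2 *
                Real.sqrt (4 * (max 1 (Real.sqrt (2 * Real.log (1 / (ε / (15 * π * 8 * 4096 * (K : ℝ)) * (1 / 64) ^ j)))) * P.δ j) / (π * (K : ℝ))) +
                8 * 15 ^ 2 * (max 1 (Real.sqrt (2 * Real.log (1 / (ε / (15 * π * 8 * 4096 * (K : ℝ)) * (1 / 64) ^ j)))) * P.δ j) / π))) +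
          Real.sqrt (∑' k : Fin 2 → ℤ, (if (K : ℤ) ≤ |k 0| ∧ ((1 : ℕ) : ℤ) * |k 0| ≤ ((4 : ℕ) : ℤ) * |k 1|
            then (1 : ℝ) else 0) * ‖mFourierCoeff (fun x => (a j x : ℂ)) k‖ ^ 2)) ^ 2 +
        ((1 + P.γ) ^ (2 * j) / ((K * 2 ^ (7 * j + 12) : ℕ) : ℝ)) ^ 2) := by
  have hΛ01 : 1 ≤ K := le_trans (by norm_num) hK
  have hKr : (6 : ℝ) ≤ K := by exact_mod_cast hK
  have hKpos : (0 : ℝ) < K := by linarith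
  have hγ' : P.γ = ((8 : ℕ) : ℝ) := by rw [hγ]; norm_num
  have hd' : 0 < P.d := by rw [hd]; norm_num
  have hN₀' : 1 ≤ P.N₀ := by rw [hN₀]
  have hρN' : 1 ≤ P.ρN := by rw [hρN]; norm_num
  have hNj : (P.N j : ℝ) = 2 ^ j := by rw [CascadeParams.N, hN₀, hρN]; push_cast; ring
  have hKw : 5 * K * 1 + 2 * K < 8 * 1 * K := by omega
  -- the `max`-family cut-offs
  have h1 : 2 * 1 * 2 ≤ 1 * 4 := by norm_num
  have h2 : 0 * 2 ≤ 1 * K := by simp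
  have h3 : 1 * 1 * K + 2 * 1 * 2 ≤ 2 * 2 * K := by omega
  set η : ℝ := (ε / (15 * π * 8 * 4096 * (K : ℝ)) * (1 / 64) ^ j) with hη
  have hπ := Real.pi_pos
  have hηpos : 0 < η := by rw [hη]; positivity
  -- the packaged step
  have hstep := lowFibre_hstep_canonicalOsc_le P hγ' hδ₀ hd' hN₀' hρN' a b has h0 hb hab j (K := 5 * K)
    (u' := 1) (v' := 4) (qn := 2) (qd := 1) (Λ0 := K) (by norm_num) hKw hΛ01
    (fun m => max (2 * 1 * (K * 2 ^ m) / 4) 0)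
    (fun m => canonMax_Q₁_lt_Q₂ (by norm_num) (by norm_num) (by norm_num) h1 h2 h3 m)
    (fun m => canonMax_feed (by norm_num) 0 K m) (rs := 2) (fun m => fat_cutoff_le hK m) (7 * j + 12) hηpos hMδ
  -- the exact constants of the canonical step at window `5K`, floor `K`, `q = 2/1`, `G = 8`: `A* = 15`, `D₀ = K`
  have eratio : ((((5 * K : ℕ) : ℝ)) * ((1 : ℕ) : ℝ) + (((2 : ℕ) : ℝ) + ((8 : ℕ) : ℝ) * ((1 : ℕ) : ℝ)) * (K : ℝ)) /
      ((((8 : ℕ) : ℝ) * ((1 : ℕ) : ℝ) - ((2 : ℕ) : ℝ)) * (K : ℝ) - ((5 * K : ℕ) : ℝ) * ((1 : ℕ) : ℝ)) = 15 := by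
    push_cast; field_simp; ring
  have eD : ((((8 : ℕ) : ℝ) * ((1 : ℕ) : ℝ) - ((2 : ℕ) : ℝ)) * (K : ℝ) - ((5 * K : ℕ) : ℝ) * ((1 : ℕ) : ℝ)) / ((1 : ℕ) : ℝ) =
      (K : ℝ) := by
    push_cast; ring
  refine le_add_sq_sqrt_add_mono hstep ?_
  rw [eratio, eD, hNj]
  -- the rounding product collapses to `ε`
  have hX : (15 : ℝ) * π * ((8 : ℕ) : ℝ) * η * (K : ℝ) / 2 ^ j * 2 ^ (7 * j + 12) = ε := by
    have e2 : (2 : ℝ) ^ (7 * j + 12) = 4096 * 128 ^ j := by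
      rw [pow_add, pow_mul]; norm_num; ring
    have p1 : ((1 : ℝ) / 64) ^ j * (128 : ℝ) ^ j = (2 : ℝ) ^ j := by
      rw [← mul_pow]; norm_num
    have hne1 : (15 : ℝ) * Real.pi * 8 * 4096 * (K : ℝ) ≠ 0 := by positivity
    have hne2 : (2 : ℝ) ^ j ≠ 0 := pow_ne_zero _ two_ne_zero
    rw [hη, e2]
    push_cast
    calc (15 : ℝ) * π * 8 * (ε / (15 * π * 8 * 4096 * (K : ℝ)) * (1 / 64) ^ j) * (K : ℝ) / 2 ^ j * (4096 * 128 ^ j)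
        = ε * (((15 : ℝ) * Real.pi * 8 * 4096 * (K : ℝ)) / (15 * Real.pi * 8 * 4096 * K)) *
            ((((1 : ℝ) / 64) ^ j * 128 ^ j) / 2 ^ j) := by
          field_simp
      _ = ε := by rw [p1, div_self hne1, div_self hne2]; ring
  rw [hX]

end Cascade

end Summit.AnomalousDissipation.AnomalousDissipation.Theorems.SawtoothPulseCascade.K1Window
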